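import Literature.NumberTheory.LFunctions.KMVMomentAsymptoticsBeyondDiagonal
import HarnessLib

/-!
# The extra main terms of the KMV moment asymptotics are pinned (uniqueness of `T₁, T₂` in
`KMV2000.MomentAsymptotics`), and KMV's side condition `q̂^Δ ∉ ℕ` holds for unboundedly many primes
for every exponent `Δ ∈ (0, 2]`

Topic `Literature/NumberTheory/LFunctions` (cell landau-siegel, family B-fam / BIRTH (2)
`PrimeLevelFamEdge`). TYPED FROM the tribunal desk probe `tools-ls-desk/probes/FamTUnique.lean`
(frontier-trib-ls-1 g5, sha16 62cd49bd5b53bb8a, rc 0) at the desk's remark 2026-08-27T01:43:28Z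
(«typing `goodPrimesUnbounded_of_le_two` once would serve K_B, (M), (XL) and the conversion support
alike»); re-namespaced to `Literature.NumberTheory.LFunctions.KMV2000`, proofs verbatim. PROVED, no
named fact (`GoodPrimesUnbounded Δ'` is a predicate, decided below on `(0, 2]`).

WHY. The predicate `KMV2000.MomentAsymptotics Δlo Δhi T₁ T₂` (printed shape of
[KowalskiMichelVanderKam2000, §6 p. 19], file `KMVMomentAsymptoticsBeyondDiagonal`) quantifies over
would-be off-diagonal main terms `T₁, T₂` and carries KMV's own guard `q̂(q)^Δ ∉ ℕ`
(§2 p. 7: "with the proviso that `M` is not an integer") as a hypothesis at each level `q`. A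
statement of the form `∀ T₁ T₂, MomentAsymptotics 1 Δ T₁ T₂ → (… values of T₁, T₂ …)` (the family
route's crux `BeyondDiagonalBeatsQuarter`) is a statement about THE off-diagonal main terms only if
`T₁, T₂` are determined by the predicate; they are, at every `(Δ', P, Q)` for which primes with
`q̂(q)^{Δ'} ∉ ℕ` are unbounded — and such primes are unbounded for every `Δ' ∈ (0, 2]`.

WHAT IS PROVED.
* `GoodPrimesUnbounded Δ'` — predicate: for every `q₀` some prime `q ≥ q₀` has `q̂(q)^{Δ'} ∉ ℕ`.
* `exists_log_qhat_ge` — `log q̂(q) → ∞`.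
* `T₁_eq_of_momentAsymptotics`, `T₂_eq_of_momentAsymptotics` — two MA-consistent pairs agree at
  every `(Δ', P, Q)` of the window with `GoodPrimesUnbounded Δ'` (the two asymptotics with distinct
  main terms `ζ(2)√q̂/(Δ' log q̂)·c` resp. `2ζ(2)²q̂/(Δ'² log² q̂)·c` and errors `O(√q̂ log⁻² q̂)` resp.
  `O(q̂ log⁻³ q̂)` contradict each other once `log q̂` is large).
* `goodPrimesUnbounded_of_lt_two` (`0 < Δ' < 2`: otherwise `q ↦ n_q = q̂(q)^{Δ'}` injects the large
  primes into `ℕ` with `1/q = (2π)⁻² n_q^{−2/Δ'}` and `Σ 1/p` would converge, against Mathlib's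
  `not_summable_one_div_on_primes`), `goodPrimesUnbounded_two` (two bad primes force `4π²k = 1`,
  against `π > 3`), and the hypothesis-free corollaries `T₁_eq_of_momentAsymptotics_of_le_two`,
  `T₂_eq_of_momentAsymptotics_of_le_two` on `Δ' ≤ 2`.
(The conversion support `CentralValueFamilyHalfEdge.primeLevelFamilyTwo_EStarFam_of_beyondDiagonalValue`
(`KMVMomentsToHalfEdge`) avoids the issue differently: it picks a generic `Δ'`,
`KMV2000.exists_mem_Ioo_qhat_rpow_ne_nat`, for which ALL `q ≥ 40` are good.)

WHAT THIS IS NOT: no claim about the moment asymptotics beyond the diagonal (OPEN IN PRINT at a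
fixed level, registry famE-02) or about Landau–Siegel zeros. «The programme SEARCHES and TYPES;
no claim about Landau–Siegel zeros, Theorems 1–2 of arXiv:2211.02515 or a repaired Margin232 until a
kernel theorem says so.»

## References

* [KowalskiMichelVanderKam2000] E. Kowalski, P. Michel, J. VanderKam, J. reine angew. Math. 526
  (2000) 1–34: §1 p. 1 (`q̂ = √q/2π`), §2 p. 7 (`M ∉ ℤ`), §6 p. 19 (the two displays).
  [held: paper:doi-10-1515-crll-2000-074 p0001, p0007, p0019]
-/

noncomputable section

namespace Literature.NumberTheory.LFunctions.KMV2000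

open Polynomial



/-- «good primes for the exponent `Δ'` are unbounded»: for every `q₀` there is a prime `q ≥ q₀` with `q̂(q)^{Δ'} ∉ ℕ`
(the guard of `MomentAsymptotics`). [cite: KowalskiMichelVanderKam2000, §6 p. 19 (M = q̂^Δ ∉ ℤ)] -/
def GoodPrimesUnbounded (Δ' : ℝ) : Prop :=
  ∀ q₀ : ℕ, ∃ q : ℕ, ∃ _ : NeZero q, q.Prime ∧ q₀ ≤ q ∧ ∀ n : ℕ, (n : ℝ) ≠ qhat q ^ Δ'

/-- `log q̂(q) → ∞`: for every `B`, all large `q` have `B ≤ log q̂(q)`. [cite: KowalskiMichelVanderKam2000, §1 p. 1 (definition of q̂)] -/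
theorem exists_log_qhat_ge (B : ℝ) : ∃ N : ℕ, ∀ (q : ℕ) [NeZero q], N ≤ q → B ≤ Real.log (qhat q) := by
  refine ⟨⌈(2 * Real.pi * Real.exp B) ^ 2⌉₊, fun q _ hq => ?_⟩
  have hπ : 0 < 2 * Real.pi := by positivity
  have hq' : (2 * Real.pi * Real.exp B) ^ 2 ≤ (q : ℝ) :=
    (Nat.le_ceil _).trans (by exact_mod_cast hq)
  have hsq : 2 * Real.pi * Real.exp B ≤ Real.sqrt q := Real.le_sqrt_of_sq_le hq'
  have hqhat : Real.exp B ≤ qhat q := by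
    unfold qhat
    rw [le_div_iff₀ hπ]
    linarith
  exact (Real.le_log_iff_exp_le (lt_of_lt_of_le (Real.exp_pos B) hqhat)).2 hqhat

/-- The first extra main term is pinned: two MA-consistent `T₁` agree wherever good primes are unbounded.
[cite: KowalskiMichelVanderKam2000, §6 p. 19 (shape of the first-moment display)] -/
theorem T₁_eq_of_momentAsymptotics {Δlo Δhi : ℝ} {T₁ T₂ T₁' T₂' : ℝ → ℝ[X] → ℝ[X] → ℝ}
    (h : MomentAsymptotics Δlo Δhi T₁ T₂) (h' : MomentAsymptotics Δlo Δhi T₁' T₂')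
    {P Q : ℝ[X]} (hP : KMV2000.Admissible P) (hQ : IsEvenOrOdd Q) {Δ' : ℝ} (h1 : Δlo < Δ') (h2 : Δ' ≤ Δhi)
    (hΔ' : 0 < Δ') (hgood : GoodPrimesUnbounded Δ') : T₁ Δ' P Q = T₁' Δ' P Q := by
  by_contra hne
  obtain ⟨C, q₀, hC⟩ := h P Q hP hQ Δ' h1 h2
  obtain ⟨C', q₀', hC'⟩ := h' P Q hP hQ Δ' h1 h2
  set δ : ℝ := |T₁ Δ' P Q - T₁' Δ' P Q| with hδ
  have hδpos : 0 < δ := abs_pos.2 (sub_ne_zero.2 hne)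
  have hz : riemannZeta 2 ≠ 0 := riemannZeta_ne_zero_of_one_le_re (by norm_num)
  have hzpos : 0 < ‖riemannZeta 2‖ := norm_pos_iff.2 hz
  -- a bound B for log q̂ beyond which the two asymptotics contradict each other
  set B : ℝ := (|C| + |C'|) * Δ' / (‖riemannZeta 2‖ * δ) + 1 with hB
  obtain ⟨N, hN⟩ := exists_log_qhat_ge B
  obtain ⟨q, inst, hq, hqge, hgoodq⟩ := hgood (max (max q₀ q₀') N)
  have hq0 : q₀ ≤ q := le_trans (le_trans (le_max_left _ _) (le_max_left _ _)) hqge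
  have hq0' : q₀' ≤ q := le_trans (le_trans (le_max_right _ _) (le_max_left _ _)) hqge
  have hqN : N ≤ q := le_trans (le_max_right _ _) hqge
  have hlg : B ≤ Real.log (qhat q) := hN q hqN
  have hB1 : 1 ≤ B := by
    have : 0 ≤ (|C| + |C'|) * Δ' / (‖riemannZeta 2‖ * δ) := by positivity
    linarith
  have hlgpos : 0 < Real.log (qhat q) := by linarith
  have hqhatpos : 0 < qhat q := by
    unfold qhat
    have : 0 < (q : ℝ) := by exact_mod_cast hq.pos
    positivity
  have hspos : 0 < Real.sqrt (qhat q) := Real.sqrt_pos.2 hqhatpos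
  obtain ⟨b1, -⟩ := hC q hq hq0 hgoodq
  obtain ⟨b1', -⟩ := hC' q hq hq0' hgoodq
  -- the two main terms differ by ‖ζ(2)‖ · √q̂/(Δ' log q̂) · δ
  set L := LhPQ q P Q (qhat q ^ Δ') with hL
  set r : ℝ := Real.sqrt (qhat q) / (Δ' * Real.log (qhat q)) with hr
  have hrpos : 0 < r := by rw [hr]; positivity
  set A : ℂ := riemannZeta 2 * ((r : ℝ) : ℂ) * ((KMV2000.linForm Δ' P Q + T₁ Δ' P Q : ℝ) : ℂ) with hA
  set A' : ℂ := riemannZeta 2 * ((r : ℝ) : ℂ) * ((KMV2000.linForm Δ' P Q + T₁' Δ' P Q : ℝ) : ℂ) with hA'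
  have hdiff : ‖A - A'‖ ≤ (|C| + |C'|) * Real.sqrt (qhat q) * (Real.log (qhat q))⁻¹ ^ 2 := by
    have e : A - A' = (L - A') - (L - A) := by ring
    rw [e]
    refine (norm_sub_le _ _).trans ?_
    have hs2 : 0 ≤ Real.sqrt (qhat q) * (Real.log (qhat q))⁻¹ ^ 2 := by positivity
    have hb : ‖L - A‖ ≤ |C| * Real.sqrt (qhat q) * (Real.log (qhat q))⁻¹ ^ 2 := by
      refine b1.trans ?_
      rw [mul_assoc, mul_assoc]
      exact mul_le_mul_of_nonneg_right (le_abs_self C) hs2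
    have hb' : ‖L - A'‖ ≤ |C'| * Real.sqrt (qhat q) * (Real.log (qhat q))⁻¹ ^ 2 := by
      refine b1'.trans ?_
      rw [mul_assoc, mul_assoc]
      exact mul_le_mul_of_nonneg_right (le_abs_self C') hs2
    nlinarith
  have hnormA : ‖A - A'‖ = ‖riemannZeta 2‖ * r * δ := by
    have e : A - A' = riemannZeta 2 * ((r : ℝ) : ℂ) * (((T₁ Δ' P Q - T₁' Δ' P Q : ℝ)) : ℂ) := by
      rw [hA, hA']
      push_cast
      ring
    rw [e, norm_mul, norm_mul, Complex.norm_real, Complex.norm_real, Real.norm_eq_abs, Real.norm_eq_abs,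
      abs_of_pos hrpos, hδ]
  -- compare: ‖ζ(2)‖ r δ ≤ (|C|+|C'|) √q̂ / log² q̂, i.e. ‖ζ(2)‖ δ log q̂ / Δ' ≤ |C| + |C'|
  have key : ‖riemannZeta 2‖ * δ * Real.log (qhat q) / Δ' ≤ |C| + |C'| := by
    have h3 := hnormA ▸ hdiff
    rw [hr] at h3
    rw [div_le_iff₀ hΔ']
    have e1 : ‖riemannZeta 2‖ * (Real.sqrt (qhat q) / (Δ' * Real.log (qhat q))) * δ =
        (‖riemannZeta 2‖ * δ * Real.log (qhat q)) * (Real.sqrt (qhat q) / (Δ' * Real.log (qhat q) ^ 2)) := by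
      field_simp
    have e2 : (|C| + |C'|) * Real.sqrt (qhat q) * (Real.log (qhat q))⁻¹ ^ 2 =
        ((|C| + |C'|) * Δ') * (Real.sqrt (qhat q) / (Δ' * Real.log (qhat q) ^ 2)) := by
      field_simp
    rw [e1, e2] at h3
    have hw : 0 < Real.sqrt (qhat q) / (Δ' * Real.log (qhat q) ^ 2) := by positivity
    exact le_of_mul_le_mul_right h3 hw
  -- but log q̂ ≥ B = (|C|+|C'|)Δ'/(‖ζ(2)‖δ) + 1
  have hzd : 0 < ‖riemannZeta 2‖ * δ := mul_pos hzpos hδpos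
  have key2 : ‖riemannZeta 2‖ * δ * B / Δ' ≤ |C| + |C'| := by
    refine le_trans ?_ key
    rw [div_le_div_iff_of_pos_right hΔ']
    exact mul_le_mul_of_nonneg_left hlg hzd.le
  rw [hB] at key2
  have e3 : ‖riemannZeta 2‖ * δ * ((|C| + |C'|) * Δ' / (‖riemannZeta 2‖ * δ) + 1) / Δ' =
      (|C| + |C'|) + ‖riemannZeta 2‖ * δ / Δ' := by
    field_simp
  rw [e3] at key2
  have : 0 < ‖riemannZeta 2‖ * δ / Δ' := div_pos hzd hΔ'
  linarith

/-- The second extra main term is pinned likewise. [cite: KowalskiMichelVanderKam2000, §6 p. 19 (shape of the second-moment display)] -/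
theorem T₂_eq_of_momentAsymptotics {Δlo Δhi : ℝ} {T₁ T₂ T₁' T₂' : ℝ → ℝ[X] → ℝ[X] → ℝ}
    (h : MomentAsymptotics Δlo Δhi T₁ T₂) (h' : MomentAsymptotics Δlo Δhi T₁' T₂')
    {P Q : ℝ[X]} (hP : KMV2000.Admissible P) (hQ : IsEvenOrOdd Q) {Δ' : ℝ} (h1 : Δlo < Δ') (h2 : Δ' ≤ Δhi)
    (hΔ' : 0 < Δ') (hgood : GoodPrimesUnbounded Δ') : T₂ Δ' P Q = T₂' Δ' P Q := by
  by_contra hne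
  obtain ⟨C, q₀, hC⟩ := h P Q hP hQ Δ' h1 h2
  obtain ⟨C', q₀', hC'⟩ := h' P Q hP hQ Δ' h1 h2
  set δ : ℝ := |T₂ Δ' P Q - T₂' Δ' P Q| with hδ
  have hδpos : 0 < δ := abs_pos.2 (sub_ne_zero.2 hne)
  have hz1 : riemannZeta 2 ≠ 0 := riemannZeta_ne_zero_of_one_le_re (by norm_num)
  have hz : (2 * riemannZeta 2 ^ 2 : ℂ) ≠ 0 := by
    refine mul_ne_zero two_ne_zero (pow_ne_zero 2 hz1)
  have hzpos : 0 < ‖(2 * riemannZeta 2 ^ 2 : ℂ)‖ := norm_pos_iff.2 hz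
  set B : ℝ := (|C| + |C'|) * Δ' ^ 2 / (‖(2 * riemannZeta 2 ^ 2 : ℂ)‖ * δ) + 1 with hB
  obtain ⟨N, hN⟩ := exists_log_qhat_ge B
  obtain ⟨q, inst, hq, hqge, hgoodq⟩ := hgood (max (max q₀ q₀') N)
  have hq0 : q₀ ≤ q := le_trans (le_trans (le_max_left _ _) (le_max_left _ _)) hqge
  have hq0' : q₀' ≤ q := le_trans (le_trans (le_max_right _ _) (le_max_left _ _)) hqge
  have hqN : N ≤ q := le_trans (le_max_right _ _) hqge
  have hlg : B ≤ Real.log (qhat q) := hN q hqN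
  have hB1 : 1 ≤ B := by
    have : 0 ≤ (|C| + |C'|) * Δ' ^ 2 / (‖(2 * riemannZeta 2 ^ 2 : ℂ)‖ * δ) := by positivity
    linarith
  have hlgpos : 0 < Real.log (qhat q) := by linarith
  have hqhatpos : 0 < qhat q := by
    unfold qhat
    have : 0 < (q : ℝ) := by exact_mod_cast hq.pos
    positivity
  obtain ⟨-, b1⟩ := hC q hq hq0 hgoodq
  obtain ⟨-, b1'⟩ := hC' q hq hq0' hgoodq
  set L := QhPQ q P Q (qhat q ^ Δ') with hL
  set r : ℝ := qhat q / (Δ' ^ 2 * Real.log (qhat q) ^ 2) with hr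
  have hrpos : 0 < r := by rw [hr]; positivity
  set A : ℂ := 2 * riemannZeta 2 ^ 2 * ((r : ℝ) : ℂ) * ((KMV2000.secondMomentForm Δ' P Q + T₂ Δ' P Q : ℝ) : ℂ) with hA
  set A' : ℂ := 2 * riemannZeta 2 ^ 2 * ((r : ℝ) : ℂ) * ((KMV2000.secondMomentForm Δ' P Q + T₂' Δ' P Q : ℝ) : ℂ) with hA'
  have hdiff : ‖A - A'‖ ≤ (|C| + |C'|) * qhat q * (Real.log (qhat q))⁻¹ ^ 3 := by
    have e : A - A' = (L - A') - (L - A) := by ring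
    rw [e]
    refine (norm_sub_le _ _).trans ?_
    have hs2 : 0 ≤ qhat q * (Real.log (qhat q))⁻¹ ^ 3 := by positivity
    have hb : ‖L - A‖ ≤ |C| * qhat q * (Real.log (qhat q))⁻¹ ^ 3 := by
      refine b1.trans ?_
      rw [mul_assoc, mul_assoc]
      exact mul_le_mul_of_nonneg_right (le_abs_self C) hs2
    have hb' : ‖L - A'‖ ≤ |C'| * qhat q * (Real.log (qhat q))⁻¹ ^ 3 := by
      refine b1'.trans ?_
      rw [mul_assoc, mul_assoc]
      exact mul_le_mul_of_nonneg_right (le_abs_self C') hs2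
    nlinarith
  have hnormA : ‖A - A'‖ = ‖(2 * riemannZeta 2 ^ 2 : ℂ)‖ * r * δ := by
    have e : A - A' = (2 * riemannZeta 2 ^ 2) * ((r : ℝ) : ℂ) * (((T₂ Δ' P Q - T₂' Δ' P Q : ℝ)) : ℂ) := by
      rw [hA, hA']
      push_cast
      ring
    rw [e, norm_mul, norm_mul, Complex.norm_real, Complex.norm_real, Real.norm_eq_abs, Real.norm_eq_abs,
      abs_of_pos hrpos, hδ]
  have key : ‖(2 * riemannZeta 2 ^ 2 : ℂ)‖ * δ * Real.log (qhat q) / Δ' ^ 2 ≤ |C| + |C'| := by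
    have h3 := hnormA ▸ hdiff
    rw [hr] at h3
    have hΔ2 : 0 < Δ' ^ 2 := by positivity
    rw [div_le_iff₀ hΔ2]
    have e1 : ‖(2 * riemannZeta 2 ^ 2 : ℂ)‖ * (qhat q / (Δ' ^ 2 * Real.log (qhat q) ^ 2)) * δ =
        (‖(2 * riemannZeta 2 ^ 2 : ℂ)‖ * δ * Real.log (qhat q)) * (qhat q / (Δ' ^ 2 * Real.log (qhat q) ^ 3)) := by
      field_simp
    have e2 : (|C| + |C'|) * qhat q * (Real.log (qhat q))⁻¹ ^ 3 =
        ((|C| + |C'|) * Δ' ^ 2) * (qhat q / (Δ' ^ 2 * Real.log (qhat q) ^ 3)) := by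
      field_simp
    rw [e1, e2] at h3
    have hw : 0 < qhat q / (Δ' ^ 2 * Real.log (qhat q) ^ 3) := by positivity
    exact le_of_mul_le_mul_right h3 hw
  have hzd : 0 < ‖(2 * riemannZeta 2 ^ 2 : ℂ)‖ * δ := mul_pos hzpos hδpos
  have hΔ2 : 0 < Δ' ^ 2 := by positivity
  have key2 : ‖(2 * riemannZeta 2 ^ 2 : ℂ)‖ * δ * B / Δ' ^ 2 ≤ |C| + |C'| := by
    refine le_trans ?_ key
    rw [div_le_div_iff_of_pos_right hΔ2]
    exact mul_le_mul_of_nonneg_left hlg hzd.le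
  rw [hB] at key2
  have e3 : ‖(2 * riemannZeta 2 ^ 2 : ℂ)‖ * δ * ((|C| + |C'|) * Δ' ^ 2 / (‖(2 * riemannZeta 2 ^ 2 : ℂ)‖ * δ) + 1) / Δ' ^ 2 =
      (|C| + |C'|) + ‖(2 * riemannZeta 2 ^ 2 : ℂ)‖ * δ / Δ' ^ 2 := by
    field_simp
  rw [e3] at key2
  have : 0 < ‖(2 * riemannZeta 2 ^ 2 : ℂ)‖ * δ / Δ' ^ 2 := div_pos hzd hΔ2
  linarith

/-! ## Good primes are unbounded for every exponent `Δ' ∈ (0, 2]` (so no hypothesis remains on K_B's segments) -/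

/-- For `0 < Δ' < 2`: if all large primes `q` had `q̂(q)^{Δ'} = n_q ∈ ℕ`, then `q ↦ n_q` is injective with
`1/q = (2π)^{-2} n_q^{-2/Δ'}`, so `∑ 1/p` would converge — against Euler/Erdős (`not_summable_one_div_on_primes`).
[cite: KowalskiMichelVanderKam2000, §6 p. 19 (M = q̂^Δ ∉ ℤ)] -/
theorem goodPrimesUnbounded_of_lt_two {Δ' : ℝ} (h0 : 0 < Δ') (h2 : Δ' < 2) : GoodPrimesUnbounded Δ' := by
  by_contra H
  unfold GoodPrimesUnbounded at H
  push Not at H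
  obtain ⟨q₀, hbad⟩ := H
  have hπ : 0 < 2 * Real.pi := by positivity
  set S : Set ℕ := {n | n.Prime ∧ q₀ ≤ n} with hSdef
  have hm : ∀ n : S, ∃ m : ℕ, (m : ℝ) = (Real.sqrt (n : ℕ) / (2 * Real.pi)) ^ Δ' := fun n => by
    obtain ⟨m, hm⟩ := hbad n ⟨n.2.1.ne_zero⟩ n.2.1 n.2.2
    exact ⟨m, by simpa [qhat] using hm⟩
  choose m hm using hm
  have hinj : Function.Injective m := by
    intro a b hab
    have h : (Real.sqrt (a : ℕ) / (2 * Real.pi)) ^ Δ' = (Real.sqrt (b : ℕ) / (2 * Real.pi)) ^ Δ' := by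
      rw [← hm a, ← hm b, hab]
    rw [Real.rpow_left_inj (by positivity) (by positivity) h0.ne', div_left_inj' hπ.ne',
      Real.sqrt_inj (Nat.cast_nonneg _) (Nat.cast_nonneg _), Nat.cast_inj] at h
    exact Subtype.ext h
  set g : ℕ → ℝ := fun k => ((2 * Real.pi) ^ 2)⁻¹ * (k : ℝ) ^ (-(2 / Δ')) with hgdef
  have hexp : -(2 / Δ') < -1 := by
    rw [neg_lt_neg_iff, one_lt_div h0]
    exact h2
  have hg : Summable g := (Real.summable_nat_rpow.mpr hexp).mul_left _
  have hS : Summable (fun n : S => (1 : ℝ) / ((n : ℕ) : ℝ)) := by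
    refine (hg.comp_injective hinj).congr fun n => ?_
    have hn0 : (0 : ℝ) < ((n : ℕ) : ℝ) := by exact_mod_cast n.2.1.pos
    show ((2 * Real.pi) ^ 2)⁻¹ * (m n : ℝ) ^ (-(2 / Δ')) = 1 / ((n : ℕ) : ℝ)
    have e : Δ' * -(2 / Δ') = -((2 : ℕ) : ℝ) := by push_cast; field_simp
    rw [hm n, ← Real.rpow_mul (by positivity), e, Real.rpow_neg (by positivity), Real.rpow_natCast, div_pow,
      Real.sq_sqrt hn0.le]
    field_simp
  have hS' : Summable (S.indicator fun n : ℕ => (1 : ℝ) / (n : ℝ)) := summable_subtype_iff_indicator.mp hS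
  set T : Set ℕ := {n | n.Prime ∧ n < q₀} with hTdef
  have hT : Summable (T.indicator fun n : ℕ => (1 : ℝ) / (n : ℝ)) := by
    refine summable_of_ne_finset_zero (s := Finset.range q₀) fun n hn => ?_
    rw [Finset.mem_range, not_lt] at hn
    rw [Set.indicator_apply, if_neg]
    exact fun h => absurd h.2 (not_lt.2 hn)
  have hsum : Summable ({p : ℕ | p.Prime}.indicator fun n : ℕ => (1 : ℝ) / (n : ℝ)) := by
    refine (hS'.add hT).congr fun n => ?_
    simp only [Set.indicator_apply, hSdef, hTdef, Set.mem_setOf_eq]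
    by_cases hp : n.Prime
    · by_cases hq : q₀ ≤ n
      · simp [hp, hq, not_lt.2 hq]
      · simp [hp, hq, not_le.mp hq]
    · simp [hp]
  exact not_summable_one_div_on_primes hsum

/-- For `Δ' = 2`: two bad primes `q ≠ q'` (`q/(4π²) = n`, `q'/(4π²) = n'`) give `q·n' = q'·n`, so `q ∣ n` and
`4π²·k = 1`, against `π > 3`. [cite: KowalskiMichelVanderKam2000, §6 p. 19 (M = q̂^Δ ∉ ℤ)] -/
theorem goodPrimesUnbounded_two : GoodPrimesUnbounded 2 := by
  by_contra H
  unfold GoodPrimesUnbounded at H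
  push Not at H
  obtain ⟨q₀, hbad⟩ := H
  obtain ⟨p, hp₀, hp⟩ := Nat.exists_infinite_primes q₀
  obtain ⟨p', hp'₀, hp'⟩ := Nat.exists_infinite_primes (p + 1)
  obtain ⟨n, hn⟩ := hbad p ⟨hp.ne_zero⟩ hp hp₀
  obtain ⟨n', hn'⟩ := hbad p' ⟨hp'.ne_zero⟩ hp' (by omega)
  have hπ : 0 < 2 * Real.pi := by positivity
  have e1 : (n : ℝ) * (2 * Real.pi) ^ 2 = p := by
    rw [hn]
    simp only [qhat, Real.rpow_two, div_pow, Real.sq_sqrt (Nat.cast_nonneg _)]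
    field_simp
  have e2 : (n' : ℝ) * (2 * Real.pi) ^ 2 = p' := by
    rw [hn']
    simp only [qhat, Real.rpow_two, div_pow, Real.sq_sqrt (Nat.cast_nonneg _)]
    field_simp
  have key : (p : ℝ) * n' = p' * n := by rw [← e1, ← e2]; ring
  have keyN : p * n' = p' * n := by exact_mod_cast key
  have hn0 : n ≠ 0 := by
    rintro rfl
    have : (p : ℝ) = 0 := by rw [← e1]; simp
    exact hp.ne_zero (by exact_mod_cast this)
  have hdvd : p ∣ p' * n := ⟨n', by rw [← keyN, mul_comm]⟩
  rcases (Nat.Prime.dvd_mul hp).1 hdvd with h | h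
  · have := (Nat.prime_dvd_prime_iff_eq hp hp').1 h
    omega
  · obtain ⟨k, rfl⟩ := h
    have hk : 1 ≤ k := Nat.one_le_iff_ne_zero.2 (by rintro rfl; exact hn0 (by simp))
    have e3 : (k : ℝ) * (2 * Real.pi) ^ 2 = 1 := by
      have hp0 : (p : ℝ) ≠ 0 := by exact_mod_cast hp.ne_zero
      have := e1
      push_cast at this
      -- p * k * (2π)² = p
      have h4 : (p : ℝ) * ((k : ℝ) * (2 * Real.pi) ^ 2) = (p : ℝ) * 1 := by
        rw [mul_one]
        calc (p : ℝ) * ((k : ℝ) * (2 * Real.pi) ^ 2) = (p : ℝ) * k * (2 * Real.pi) ^ 2 := by ring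
          _ = (p : ℝ) := this
      exact mul_left_cancel₀ hp0 h4
    have hk1 : (1 : ℝ) ≤ k := by exact_mod_cast hk
    have hπ3 : (3 : ℝ) < Real.pi := Real.pi_gt_three
    nlinarith

/-- Hence on `(0, 2]` no hypothesis remains: MA-consistent `T₁`'s agree (the case K_B / stubs (M), (XL) use).
[cite: KowalskiMichelVanderKam2000, §6 p. 19] -/
theorem T₁_eq_of_momentAsymptotics_of_le_two {Δlo Δhi : ℝ} {T₁ T₂ T₁' T₂' : ℝ → ℝ[X] → ℝ[X] → ℝ}
    (h : MomentAsymptotics Δlo Δhi T₁ T₂) (h' : MomentAsymptotics Δlo Δhi T₁' T₂')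
    {P Q : ℝ[X]} (hP : KMV2000.Admissible P) (hQ : IsEvenOrOdd Q) {Δ' : ℝ} (h1 : Δlo < Δ') (h2 : Δ' ≤ Δhi)
    (hΔ' : 0 < Δ') (hΔ2 : Δ' ≤ 2) : T₁ Δ' P Q = T₁' Δ' P Q := by
  rcases eq_or_lt_of_le hΔ2 with rfl | hlt
  · exact T₁_eq_of_momentAsymptotics h h' hP hQ h1 h2 hΔ' goodPrimesUnbounded_two
  · exact T₁_eq_of_momentAsymptotics h h' hP hQ h1 h2 hΔ' (goodPrimesUnbounded_of_lt_two hΔ' hlt)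

/-- … and so do MA-consistent `T₂`'s. [cite: KowalskiMichelVanderKam2000, §6 p. 19] -/
theorem T₂_eq_of_momentAsymptotics_of_le_two {Δlo Δhi : ℝ} {T₁ T₂ T₁' T₂' : ℝ → ℝ[X] → ℝ[X] → ℝ}
    (h : MomentAsymptotics Δlo Δhi T₁ T₂) (h' : MomentAsymptotics Δlo Δhi T₁' T₂')
    {P Q : ℝ[X]} (hP : KMV2000.Admissible P) (hQ : IsEvenOrOdd Q) {Δ' : ℝ} (h1 : Δlo < Δ') (h2 : Δ' ≤ Δhi)
    (hΔ' : 0 < Δ') (hΔ2 : Δ' ≤ 2) : T₂ Δ' P Q = T₂' Δ' P Q := by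
  rcases eq_or_lt_of_le hΔ2 with rfl | hlt
  · exact T₂_eq_of_momentAsymptotics h h' hP hQ h1 h2 hΔ' goodPrimesUnbounded_two
  · exact T₂_eq_of_momentAsymptotics h h' hP hQ h1 h2 hΔ' (goodPrimesUnbounded_of_lt_two hΔ' hlt)

end Literature.NumberTheory.LFunctions.KMV2000
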